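import Summits.QuantumFields.YangMills.Theorems.UnitScaleTiltProp7MassivePropagatorCoercive
import Summits.QuantumFields.YangMills.Theorems.UnitScaleTiltProp7ComplementaryProjectorBlockDecayKnit
import Summits.QuantumFields.YangMills.Theorems.UnitScaleTiltProp7KatoBootstrapMember
import HarnessLib

/-!
# Route `UnitScaleTilt`, crux K1 «MinimiserStabilityRegPr» (stmt-QuantumFields-19200), EX face after S45 — **(L3′b)-VALUE FILE V2: THE SUP-NORM (VALUE) ROW OF THE
# MASSIVE SITE PROPAGATOR `G_a = (Δ_{U₀} + a·Q″†Q″)⁻¹` OF THE LOD LINE AT A CURVED BACKGROUND, K-FREE** (★★OWNER RULING №35-A (b); chair ★`ym-ust-19200-p1` g25's own pen, over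
# V1 ✓`Prop7KatoBootstrapMember` (the Kato bootstrap at the member) and px5's ✓`Prop7MassivePropagatorCoercive` (the energy letter) ∕ ✓`Prop7MassivePropagatorAgmonLetters` (the spike rows of `Q″`))

Cell `ym3-torus` (HUMAN RULING D-0037; rung R3 = SU(2) YM₃ on T³ — NOT d = 4, NOT infinite volume, NOT a mass gap, NOT Clay).
THEOREMS ONLY (0 `def`, 0 `sorry`, default heartbeats); `--supports stmt-QuantumFields-19200 --as helper`; count-neutral.

THE OBJECTS (hypothesis-form, as in ✓`Prop7MassivePropagatorCoercive`).  `E := SiteL2K ℂ 3 (periodsT3 F K) c₀ W₂`; `U₀ ∈ RegPr F n K ε₀` (`10⁷L³ε₀ ≤ 1`); `Q″` any top nested mean of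
record (clauses (iii)+(iv) of ✓`exists_intertwiner_of_regPr`, `hseq`); `ι` the block-constant lift into `SiteL2K ℂ 3 (periodsT3 F n) c₁ W₂` (`hι`); `T` any adjoint of `ι∘Q″` (`hT`);
the MASSIVE EQUATION `Δ^η_{U₀}u + a·T(ι(Q″u)) = f` (print's `Δ′_a u = f`, (3.24)–(3.25)).
WHAT IS PROVED (ns `Summit.QuantumFields.YangMills.Theorems.Prop7MassivePropagatorSupBound`).
* §1 THE PENALTY LETTER (P) OF THE BOOTSTRAP FOR `a·Q″†Q″`, K-FREE: `norm_lift_topMean_single_le` (`‖ι(Q″(δ_x⊗X))‖ ≤ (5∕4)√(2c₁)·ℓ⁻³·‖X‖` — ✓`norm_topMean_single_le` + ✓`topMean_toL2S_single_eq`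
  + ✓`normSq_toL2S_comp_siteShift_eq`), ★`norm_equiv_adjoint_apply_le` (the SPIKE TEST: `‖(T g)(x)‖_{W₂} ≤ (5∕4)√(2c₁)∕(c₀ℓ³)·‖g‖` for EVERY adjoint `T` of `ι∘Q″` — ✓`inner_toL2S_single_left`
  with the spike `δ_x ⊗ (Tg)(x)`), routeR-w2's ✓`norm_lift_topMean_le` (`‖ι(Q″u)‖ ≤ √((25∕8)·c₁∕(c₀ℓ³))·‖u‖`) ⟹ ★`norm_equiv_penalty_apply_le`
  (`‖(a·T(ι(Q″u)))(x)‖ ≤ p₂·‖u‖`, `p₂ = (25∕8)·a·c₁·(c₀ℓ³)⁻¹·√((c₀ℓ³)⁻¹)`).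
* §2 ★★★ `norm_equiv_massive_solution_le` — THE VALUE ROW: for `Δ^η_{U₀}u + a·T(ι(Q″u)) = f` with `f` vanishing off a finite set `S` of sites and `‖f(y)‖ ≤ F_b`:
  `‖u(x)‖ ≤ (2 + (2p₂ + √(3³∕(c₀ℓ³)))·C_P²·√(c₀·#S))·F_b` at EVERY site, `C_P² = max 2 (16c₀ℓ³∕(a·c₁))` (✓`norm_le_of_massive_eq`) — V1 ✓`norm_apply_le_of_kato_member_block` with
  (E) := px5's energy letter and (P) := §1.  At the pins `c₁ = c₀ℓ³`, `#S = ℓ³` (one block): `B₀ = 2 + ((25∕4)a + √27)·max 2 (16∕a)` — NO `K`, NO `n`, NO volume: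
  print's «|(G′(U)λ)(x)| ≤ B₀·|λ| for supp λ ⊂ Δ(y′)» ([B9] Thm 3.1 (3.42), first entry, `L^jη = 1`) for the LOD line's `G_a` at every printed-regular background of the member;
  ★ `norm_symm_massive_solution_le` — the same read on the route's site functions (`‖(toL2S⁻¹u)(x)‖ ≤ …`, ✓`norm_frobEquiv_le`).
HONEST SCOPE.  Composition of landed rows (V1 + px5's coercivity∕spike rows); CONDITIONAL on nothing displayed beyond the LOD letters `hseq hι hT` and `RegPr`; this is the VALUE row only —
no decay factor (V3, w5 g14), no gradient (the (L3′b)-GRAD joint key), no one-form operator `G = Δ_a⁻¹`; nothing of the ten EX rows, `hT`, `hGF`, EX `stub_existenceMinimalOrbit` or the crux is proved.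

References: T. Bałaban, CMP **99** (1985) 389–434 [Balaban1985BackgroundPropagators] ((3.11) p.392, (3.16) p.393, (3.19) p.393, (3.24)–(3.25) p.394, Thm 3.1 (3.42) p.397);
CMP **98** (1985) 17–51 [Balaban1985Averaging] ((97) p.32); J. Dodziuk, V. Mathai, Contemp. Math. **398** (2006) [DodziukMathai2006] (§1).
-/

set_option autoImplicit false

noncomputable section

open scoped BigOperators Matrix.Norms.L2Operator InnerProductSpace ComplexConjugate

namespace Summit.QuantumFields.YangMills.Theorems.Prop7MassivePropagatorSupBound

open Literature.MathematicalPhysics.QuantumFieldTheory.Balaban1983to89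
open Finset
open T4Continuum BlockAveraging
open BlockAveraging (Idx)
open B7Prop1Explicit (U1 disp)
open B5Eq118OneStroke (iterBlockOf iterBlock)
open B10Eq27TorusAxialLog (holT transl)
open B7TransferAnalyticMean (meanCLM)
open B4Sect5Torus (TSite)
open B9Eq311L2Pairing (WL2)
open B11Eq103H1Complex (SiteL2K BondL2K)
open Summit.QuantumFields.YangMills.Theorems.Prop8Chart (emlIterU)
open Literature.MathematicalPhysics.QuantumFieldTheory.Balaban1983to89.T3ContinuumYM3Torus
open T3SectALandauChart (eta eta_pos bgUnits)
open T3PrintedRegularMinimiser (RegPr)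
open T3PrintedRegularOrbits (sites_eq)
open T3LevelShift (siteShift)
open Summit.QuantumFields.YangMills.Theorems.Prop7SectET3Transport (periodsT3 siteEquiv)
open Summit.QuantumFields.YangMills.Theorems.Prop7SectET3HilbertLetters (W₂ frobEquiv toL2S covLapSite toL2S_apply toL2S_symm_apply inner_frobEquiv_symm)
open Summit.QuantumFields.YangMills.Theorems.Prop7RieszTauFrobNorm (norm_frobEquiv_le)
open Summit.QuantumFields.YangMills.Theorems.Prop7BlockBumpExtension (normSq_toL2S_comp_siteShift_eq)
open Summit.QuantumFields.YangMills.Theorems.Prop7CovariantCoercivity (sum_norm_sq_le_mul_opNorm_sq)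
open Summit.QuantumFields.YangMills.Theorems.Prop7TopMeanAdjointBlockLocal (inner_toL2S_single_left topMean_toL2S_single_eq)
open Summit.QuantumFields.YangMills.Theorems.Prop7MassivePropagatorAgmonLetters (norm_topMean_single_le normSq_lift_topMean_le)
open Summit.QuantumFields.YangMills.Theorems.Prop7MassivePropagatorCoercive (norm_le_of_massive_eq)
open Summit.QuantumFields.YangMills.Theorems.Prop7ComplementaryProjectorBlockDecay (norm_lift_topMean_le)
open Summit.QuantumFields.YangMills.Theorems.Prop7KatoBootstrapMember (norm_apply_le_of_kato_member_block)

variable (F : T3Family) {n K : ℕ} (h : n ≤ K) {c₀ c₁ : ℝ} [Fact (0 < c₀)] [Fact (0 < c₁)]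
  {ε₀ : ℝ} (hε₀ : 0 < ε₀) (hε7 : 10 ^ 7 * (F.L : ℝ) ^ 3 * ε₀ ≤ 1)
  (U₀ : GaugeField (F.P K) 0 (Matrix.specialUnitaryGroup (Fin 2) ℂ)) (hreg : RegPr F n K ε₀ U₀)
  (Q'' : SiteL2K ℂ 3 (periodsT3 F K) c₀ W₂ →ₗ[ℂ] (Site (F.P K) (K - n) → Matrix (Fin 2) (Fin 2) ℂ))
  (hseq : ∀ lam : Site (F.P K) 0 → Matrix (Fin 2) (Fin 2) ℂ, ∃ ns : (j : ℕ) → Site (F.P K) j → Matrix (Fin 2) (Fin 2) ℂ, ns 0 = lam ∧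
      (∀ (j : ℕ) (y : Site (F.P K) (j + 1)), ns (j + 1) y = ns j (emb y) - meanCLM (Idx (F.P K)) (Matrix (Fin 2) (Fin 2) ℂ) fun i : Idx (F.P K) =>
        ns j (emb y) - ((holT (emlIterU j (bgUnits F K U₀)) (emb y) (stairWord i.2.1 (off i.1)) : (Matrix (Fin 2) (Fin 2) ℂ)ˣ) : Matrix (Fin 2) (Fin 2) ℂ) *
          ns j (transl (emb y) (disp (stairWord i.2.1 (off i.1)))) * (((holT (emlIterU j (bgUnits F K U₀)) (emb y) (stairWord i.2.1 (off i.1)))⁻¹ : (Matrix (Fin 2) (Fin 2) ℂ)ˣ) : Matrix (Fin 2) (Fin 2) ℂ)) ∧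
      ns (K - n) = Q'' (toL2S F K c₀ lam))
  (ι : (Site (F.P K) (K - n) → Matrix (Fin 2) (Fin 2) ℂ) →ₗ[ℂ] SiteL2K ℂ 3 (periodsT3 F n) c₁ W₂)
  (hι : ∀ c, ι c = toL2S F n c₁ (fun z => c (siteShift (sites_eq F n K h) z)))
  (T : SiteL2K ℂ 3 (periodsT3 F n) c₁ W₂ →ₗ[ℂ] SiteL2K ℂ 3 (periodsT3 F K) c₀ W₂)
  (hT : ∀ (l : SiteL2K ℂ 3 (periodsT3 F K) c₀ W₂) (f : SiteL2K ℂ 3 (periodsT3 F n) c₁ W₂), ⟪ι (Q'' l), f⟫_ℂ = ⟪l, T f⟫_ℂ)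
  {a : ℝ} (ha : 0 < a)

/-! ## §1 The penalty letter (P) for `a·Q″†Q″`, K-free -/

include hε₀ hε7 hreg hseq hι in
/-- **THE LIFT OF THE TOP MEAN OF A SPIKE IS SMALL**: `‖ι(Q″(toL2S(δ_x ⊗ X)))‖ ≤ (5∕4)·√(2c₁)·ℓ⁻³·‖X‖` (`ℓ³ = (L^d)^{K−n}`) — the top mean of a spike is supported at its block
(✓`topMean_toL2S_single_eq`) with value `≤ (5∕4)ℓ⁻³‖X‖` (✓`norm_topMean_single_le`), and `‖ι c‖² = c₁·Σ‖c‖²_F ≤ 2c₁·Σ‖c‖²_op` (✓`normSq_toL2S_comp_siteShift_eq`).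
[cite: Balaban1985Averaging, (97) p.32; Balaban1985BackgroundPropagators, (3.16) p.393, (3.19) p.393] -/
theorem norm_lift_topMean_single_le (x : Site (F.P K) 0) (X : Matrix (Fin 2) (Fin 2) ℂ) :
    ‖ι (Q'' (toL2S F K c₀ (Pi.single x X)))‖
      ≤ (5 / 4) * Real.sqrt (2 * c₁) * ((((F.P K).L : ℝ) ^ (F.P K).d) ^ (K - n))⁻¹ * ‖X‖ := by
  classical
  have hc₁ : 0 < c₁ := Fact.out
  set cvol : ℝ := ((((F.P K).L : ℝ) ^ (F.P K).d) ^ (K - n))⁻¹ with hcvol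
  have hcvol0 : 0 ≤ cvol := by rw [hcvol]; have := (F.P K).L_pos; positivity
  set c : Site (F.P K) (K - n) → Matrix (Fin 2) (Fin 2) ℂ := Q'' (toL2S F K c₀ (Pi.single x X)) with hc_def
  set y₀ : Site (F.P K) (K - n) := iterBlockOf (K - n) x with hy₀
  -- the top mean of a spike is supported at `y₀`, with value `≤ (5/4)·cvol·‖X‖`
  have hsupp : c = Pi.single y₀ (c y₀) := by rw [hc_def, hy₀]; exact topMean_toL2S_single_eq F U₀ Q'' hseq x X
  have hval : ‖c y₀‖ ≤ (5 / 4) * (cvol * ‖X‖) := by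
    have h1 := norm_topMean_single_le F hε₀ hε7 U₀ hreg Q'' hseq x X y₀
    refine h1.trans (mul_le_mul_of_nonneg_left (mul_le_mul_of_nonneg_left ?_ hcvol0) (by norm_num))
    split_ifs
    · exact le_rfl
    · exact norm_nonneg _
  -- `‖ι c‖² = c₁·Σ_y Σ_jk ‖c y j k‖² = c₁·Σ_jk ‖c y₀ j k‖² ≤ 2c₁‖c y₀‖²`
  have hnormsq : ‖ι c‖ ^ 2 ≤ 2 * c₁ * ((5 / 4) * (cvol * ‖X‖)) ^ 2 := by
    rw [hι, normSq_toL2S_comp_siteShift_eq F h]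
    have hsum : ∑ Y : Site (F.P K) (K - n), ∑ j : Fin 2, ∑ k : Fin 2, ‖c Y j k‖ ^ 2 = ∑ j : Fin 2, ∑ k : Fin 2, ‖c y₀ j k‖ ^ 2 := by
      rw [Finset.sum_eq_single y₀]
      · intro Y _ hY
        have hY0 : c Y = 0 := by rw [hsupp, Pi.single_eq_of_ne hY]
        simp [hY0]
      · intro hy; exact absurd (Finset.mem_univ y₀) hy
    rw [hsum]
    have h2 : ∑ j : Fin 2, ∑ k : Fin 2, ‖c y₀ j k‖ ^ 2 ≤ 2 * ‖c y₀‖ ^ 2 := by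
      have := sum_norm_sq_le_mul_opNorm_sq (N := 2) (c y₀)
      simpa using this
    have h3 : ‖c y₀‖ ^ 2 ≤ ((5 / 4) * (cvol * ‖X‖)) ^ 2 := pow_le_pow_left₀ (norm_nonneg _) hval 2
    nlinarith [hc₁.le]
  have hR0 : 0 ≤ (5 / 4) * Real.sqrt (2 * c₁) * cvol * ‖X‖ := by positivity
  have hsq : ‖ι c‖ ^ 2 ≤ ((5 / 4) * Real.sqrt (2 * c₁) * cvol * ‖X‖) ^ 2 := by
    have e : ((5 / 4) * Real.sqrt (2 * c₁) * cvol * ‖X‖) ^ 2 = 2 * c₁ * ((5 / 4) * (cvol * ‖X‖)) ^ 2 := by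
      rw [mul_pow, mul_pow, mul_pow, Real.sq_sqrt (by positivity)]; ring
    rw [e]; exact hnormsq
  exact (pow_le_pow_iff_left₀ (norm_nonneg _) hR0 two_ne_zero).mp hsq

include hε₀ hε7 hreg hseq hι hT in
/-- ★ **THE SPIKE TEST — THE VALUES OF `T g` FOR EVERY ADJOINT `T` OF `ι∘Q″`**: at every fine site, `‖(Tg)(x)‖_{W₂} ≤ (5∕4)√(2c₁)∕(c₀ℓ³)·‖g‖` — pair `Tg` with the spike
`δ_x ⊗ (Tg)(x)` (✓`inner_toL2S_single_left`: `c₀·‖(Tg)(x)‖²_F`), move `T` across by `hT`, bound by Cauchy–Schwarz and `norm_lift_topMean_single_le`, and use `‖frobEquiv v‖ ≤ ‖v‖`.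
[cite: Balaban1985BackgroundPropagators, (3.11) p.392, (3.16) p.393, (3.24) p.394] -/
theorem norm_equiv_adjoint_apply_le (g : SiteL2K ℂ 3 (periodsT3 F n) c₁ W₂) (xt : TSite 3 (periodsT3 F K)) :
    ‖WL2.equiv ℂ _ W₂ (T g) xt‖
      ≤ (5 / 4) * Real.sqrt (2 * c₁) * ((((F.P K).L : ℝ) ^ (F.P K).d) ^ (K - n))⁻¹ / c₀ * ‖g‖ := by
  classical
  have hc₀ : 0 < c₀ := Fact.out
  set cvol : ℝ := ((((F.P K).L : ℝ) ^ (F.P K).d) ^ (K - n))⁻¹ with hcvol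
  set v : W₂ := WL2.equiv ℂ _ W₂ (T g) xt with hv
  set x : Site (F.P K) 0 := (siteEquiv F K).symm xt with hx
  set M : Matrix (Fin 2) (Fin 2) ℂ := frobEquiv v with hM
  -- the route reading of `T g` at `x` is `M`
  have hread : (toL2S F K c₀).symm (T g) x = M := by
    rw [toL2S_symm_apply, hx, Equiv.apply_symm_apply]
  -- the spike test: `re⟪toL2S(δ_x ⊗ M), T g⟫ = c₀·re tr(Mᴴ M) = c₀‖v‖²`
  have hpair : RCLike.re ⟪toL2S F K c₀ (Pi.single x M), T g⟫_ℂ = c₀ * ‖v‖ ^ 2 := by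
    have h1 : T g = toL2S F K c₀ ((toL2S F K c₀).symm (T g)) := ((toL2S F K c₀).apply_symm_apply (T g)).symm
    rw [h1, inner_toL2S_single_left, hread, ← inner_frobEquiv_symm, hM, LinearEquiv.symm_apply_apply,
      RCLike.re_to_complex, Complex.re_ofReal_mul]
    congr 1
    rw [← RCLike.re_to_complex]
    exact inner_self_eq_norm_sq (𝕜 := ℂ) v
  -- move `T` across and bound
  have hadj : ⟪toL2S F K c₀ (Pi.single x M), T g⟫_ℂ = ⟪ι (Q'' (toL2S F K c₀ (Pi.single x M))), g⟫_ℂ := (hT _ g).symm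
  have hCS : c₀ * ‖v‖ ^ 2 ≤ ((5 / 4) * Real.sqrt (2 * c₁) * cvol * ‖M‖) * ‖g‖ := by
    have h1 : RCLike.re ⟪ι (Q'' (toL2S F K c₀ (Pi.single x M))), g⟫_ℂ ≤ ‖ι (Q'' (toL2S F K c₀ (Pi.single x M)))‖ * ‖g‖ :=
      (RCLike.re_le_norm _).trans (norm_inner_le_norm _ _)
    have h2 := norm_lift_topMean_single_le F h hε₀ hε7 U₀ hreg Q'' hseq ι hι x M
    rw [← hpair, hadj]
    exact h1.trans (mul_le_mul_of_nonneg_right h2 (norm_nonneg _))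
  have hMv : ‖M‖ ≤ ‖v‖ := by rw [hM]; exact norm_frobEquiv_le v
  have hA0 : 0 ≤ (5 / 4) * Real.sqrt (2 * c₁) * cvol := by
    rw [hcvol]; have := (F.P K).L_pos; positivity
  have hCS' : c₀ * ‖v‖ ^ 2 ≤ ((5 / 4) * Real.sqrt (2 * c₁) * cvol * ‖g‖) * ‖v‖ := by
    calc c₀ * ‖v‖ ^ 2 ≤ ((5 / 4) * Real.sqrt (2 * c₁) * cvol * ‖M‖) * ‖g‖ := hCS
      _ ≤ ((5 / 4) * Real.sqrt (2 * c₁) * cvol * ‖v‖) * ‖g‖ :=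
          mul_le_mul_of_nonneg_right (mul_le_mul_of_nonneg_left hMv hA0) (norm_nonneg _)
      _ = ((5 / 4) * Real.sqrt (2 * c₁) * cvol * ‖g‖) * ‖v‖ := by ring
  by_cases hv0 : ‖v‖ = 0
  · rw [hv0]; positivity
  · have hvpos : 0 < ‖v‖ := lt_of_le_of_ne (norm_nonneg _) (Ne.symm hv0)
    have h4 : c₀ * ‖v‖ ≤ (5 / 4) * Real.sqrt (2 * c₁) * cvol * ‖g‖ := by
      have := hCS'
      rw [sq, ← mul_assoc] at this
      exact le_of_mul_le_mul_right this hvpos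
    calc ‖v‖ = (c₀ * ‖v‖) / c₀ := by field_simp
      _ ≤ ((5 / 4) * Real.sqrt (2 * c₁) * cvol * ‖g‖) / c₀ := div_le_div_of_nonneg_right h4 hc₀.le
      _ = (5 / 4) * Real.sqrt (2 * c₁) * cvol / c₀ * ‖g‖ := by ring

include hε₀ hε7 hreg hseq hι hT ha in
/-- ★ **THE PENALTY LETTER (P)**: `‖(a·T(ι(Q″u)))(x)‖_{W₂} ≤ p₂·‖u‖` with `p₂ = a·((5∕4)√(2c₁)ℓ⁻³∕c₀)·√((25∕8)c₁ℓ⁻³∕c₀)` — K-FREE at the pin `c₁ = c₀ℓ³` after the bootstrap's `√(c₀ℓ³)`.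
[cite: Balaban1985BackgroundPropagators, (3.24) p.394, Thm 3.1 (3.42) p.397] -/
theorem norm_equiv_penalty_apply_le (u : SiteL2K ℂ 3 (periodsT3 F K) c₀ W₂) (xt : TSite 3 (periodsT3 F K)) :
    ‖WL2.equiv ℂ _ W₂ ((a : ℂ) • T (ι (Q'' u))) xt‖
      ≤ (a * ((5 / 4) * Real.sqrt (2 * c₁) * ((((F.P K).L : ℝ) ^ (F.P K).d) ^ (K - n))⁻¹ / c₀) *
          Real.sqrt ((25 / 8) * (c₁ * ((((F.P K).L : ℝ) ^ (F.P K).d) ^ (K - n))⁻¹ / c₀))) * ‖u‖ := by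
  have hc₀ : 0 < c₀ := Fact.out
  have h1 := norm_equiv_adjoint_apply_le F h hε₀ hε7 U₀ hreg Q'' hseq ι hι T hT (ι (Q'' u)) xt
  have h2 := norm_lift_topMean_le F h hε₀ hε7 U₀ hreg Q'' hseq ι hι u
  have hA0 : 0 ≤ (5 / 4) * Real.sqrt (2 * c₁) * ((((F.P K).L : ℝ) ^ (F.P K).d) ^ (K - n))⁻¹ / c₀ := by
    have := (F.P K).L_pos; positivity
  rw [WL2.equiv_smul, Pi.smul_apply, norm_smul, Complex.norm_real, Real.norm_of_nonneg ha.le]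
  calc a * ‖WL2.equiv ℂ _ W₂ (T (ι (Q'' u))) xt‖
      ≤ a * ((5 / 4) * Real.sqrt (2 * c₁) * ((((F.P K).L : ℝ) ^ (F.P K).d) ^ (K - n))⁻¹ / c₀ * ‖ι (Q'' u)‖) := mul_le_mul_of_nonneg_left h1 ha.le
    _ ≤ a * ((5 / 4) * Real.sqrt (2 * c₁) * ((((F.P K).L : ℝ) ^ (F.P K).d) ^ (K - n))⁻¹ / c₀ *
          (Real.sqrt ((25 / 8) * (c₁ * ((((F.P K).L : ℝ) ^ (F.P K).d) ^ (K - n))⁻¹ / c₀)) * ‖u‖)) :=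
        mul_le_mul_of_nonneg_left (mul_le_mul_of_nonneg_left h2 hA0) ha.le
    _ = _ := by ring

/-! ## §2 The value row of the massive propagator -/

include hε₀ hε7 hreg hseq hι hT ha in
/-- ★★★ **THE SUP-NORM (VALUE) ROW OF `G_a` AT A CURVED BACKGROUND, K-FREE**: for `U₀ ∈ RegPr F n K ε₀` (`10⁷L³ε₀ ≤ 1`), ANY top mean of record `Q″` with lift `ι` and adjoint `T`, and
the solution `u` of the massive equation `Δ^η_{U₀}u + a·T(ι(Q″u)) = f` with `f` vanishing off a finite set `S` of sites and `‖f(y)‖ ≤ F_b` pointwise: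
`‖u(x)‖ ≤ (2 + (2p₂ + √(3³∕(c₀ℓ³)))·C_P²·√(c₀·#S))·F_b` at EVERY site (`C_P² = max 2 (16c₀ℓ³∕(a·c₁))`, `p₂` of `norm_equiv_penalty_apply_le`).  At `c₁ = c₀ℓ³`, `#S = ℓ³`:
`B₀ = 2 + ((25∕4)a + √27)·max 2 (16∕a)`.  V1's Kato bootstrap with (E) := ✓`norm_le_of_massive_eq`, (P) := §1.
[cite: Balaban1985BackgroundPropagators, Thm 3.1 (3.42) p.397, (3.24)–(3.25) p.394; DodziukMathai2006, §1] -/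
theorem norm_equiv_massive_solution_le (u f : SiteL2K ℂ 3 (periodsT3 F K) c₀ W₂)
    (hAu : covLapSite F n K c₀ U₀ u + (a : ℂ) • T (ι (Q'' u)) = f)
    (S : Finset (TSite 3 (periodsT3 F K))) (hfS : ∀ y, y ∉ S → WL2.equiv ℂ _ W₂ f y = 0)
    {Fb : ℝ} (hF : ∀ y, ‖WL2.equiv ℂ _ W₂ f y‖ ≤ Fb) (xt : TSite 3 (periodsT3 F K)) :
    ‖WL2.equiv ℂ _ W₂ u xt‖
      ≤ (2 + (2 * (a * ((5 / 4) * Real.sqrt (2 * c₁) * ((((F.P K).L : ℝ) ^ (F.P K).d) ^ (K - n))⁻¹ / c₀) *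
                  Real.sqrt ((25 / 8) * (c₁ * ((((F.P K).L : ℝ) ^ (F.P K).d) ^ (K - n))⁻¹ / c₀)))
              + Real.sqrt (3 ^ 3 / (c₀ * ((F.L : ℝ) ^ (K - n)) ^ 3)))
            * max 2 (16 * c₀ * ((F.L : ℝ) ^ (K - n)) ^ 3 / (a * c₁)) * Real.sqrt (c₀ * S.card)) * Fb := by
  -- the massive equation as `Δ^η u = f − q`, `q = a·T(ι(Q″u))`
  set q : SiteL2K ℂ 3 (periodsT3 F K) c₀ W₂ := (a : ℂ) • T (ι (Q'' u)) with hq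
  have hu : covLapSite F n K c₀ U₀ u = f - q := by rw [← hAu, hq]; abel
  -- (E) the energy letter, (P) the penalty letter
  have hE := norm_le_of_massive_eq F h hε₀ hε7 U₀ hreg Q'' hseq ι hι T hT ha u f hAu
  have hPq : ∀ y, ‖WL2.equiv ℂ _ W₂ q y‖ ≤ (a * ((5 / 4) * Real.sqrt (2 * c₁) * ((((F.P K).L : ℝ) ^ (F.P K).d) ^ (K - n))⁻¹ / c₀) *
      Real.sqrt ((25 / 8) * (c₁ * ((((F.P K).L : ℝ) ^ (F.P K).d) ^ (K - n))⁻¹ / c₀))) * ‖u‖ :=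
    fun y => norm_equiv_penalty_apply_le F h hε₀ hε7 U₀ hreg Q'' hseq ι hι T hT ha u y
  have hp₂ : 0 ≤ a * ((5 / 4) * Real.sqrt (2 * c₁) * ((((F.P K).L : ℝ) ^ (F.P K).d) ^ (K - n))⁻¹ / c₀) *
      Real.sqrt ((25 / 8) * (c₁ * ((((F.P K).L : ℝ) ^ (F.P K).d) ^ (K - n))⁻¹ / c₀)) := by
    have := (F.P K).L_pos; have : (0:ℝ) < c₀ := Fact.out; positivity
  have hCE : (0 : ℝ) ≤ max 2 (16 * c₀ * ((F.L : ℝ) ^ (K - n)) ^ 3 / (a * c₁)) := le_trans (by norm_num) (le_max_left _ _)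
  exact norm_apply_le_of_kato_member_block F n K c₀ h U₀ hu S hfS hF hPq hp₂ hCE hE le_rfl xt

include hε₀ hε7 hreg hseq hι hT ha in
/-- ★ **THE SAME READ ON THE ROUTE'S SITE FUNCTIONS** (operator norm of the `2×2` value ≤ its Frobenius norm, ✓`norm_frobEquiv_le`): `‖(toL2S⁻¹u)(x)‖ ≤ B·F_b`.
[cite: Balaban1985BackgroundPropagators, Thm 3.1 (3.42) p.397, (3.39) p.397] -/
theorem norm_symm_massive_solution_le (u f : SiteL2K ℂ 3 (periodsT3 F K) c₀ W₂)
    (hAu : covLapSite F n K c₀ U₀ u + (a : ℂ) • T (ι (Q'' u)) = f)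
    (S : Finset (TSite 3 (periodsT3 F K))) (hfS : ∀ y, y ∉ S → WL2.equiv ℂ _ W₂ f y = 0)
    {Fb : ℝ} (hF : ∀ y, ‖WL2.equiv ℂ _ W₂ f y‖ ≤ Fb) (x : Site (F.P K) 0) :
    ‖(toL2S F K c₀).symm u x‖
      ≤ (2 + (2 * (a * ((5 / 4) * Real.sqrt (2 * c₁) * ((((F.P K).L : ℝ) ^ (F.P K).d) ^ (K - n))⁻¹ / c₀) *
                  Real.sqrt ((25 / 8) * (c₁ * ((((F.P K).L : ℝ) ^ (F.P K).d) ^ (K - n))⁻¹ / c₀)))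
              + Real.sqrt (3 ^ 3 / (c₀ * ((F.L : ℝ) ^ (K - n)) ^ 3)))
            * max 2 (16 * c₀ * ((F.L : ℝ) ^ (K - n)) ^ 3 / (a * c₁)) * Real.sqrt (c₀ * S.card)) * Fb := by
  rw [toL2S_symm_apply]
  exact (norm_frobEquiv_le _).trans (norm_equiv_massive_solution_le F h hε₀ hε7 U₀ hreg Q'' hseq ι hι T hT ha u f hAu S hfS hF (siteEquiv F K x))

/-! ## §3 The same for the massive inverse as a letter `G` (`hAG`), the LOD line's currency -/

include hε₀ hε7 hreg hseq hι hT ha in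
/-- ★★ **THE VALUE ROW FOR THE LETTER `G = G_a`** (`hAG : Δ^η(Gf) + a·T(ι(Q″(Gf))) = f`, as in ✓`Prop7ComplementaryProjectorBlockDecay`∕✓`Prop7ProjRangeKernelDecayCoarseGram`): for `f`
vanishing off `S` with `‖f(y)‖ ≤ F_b`, `‖(Gf)(x)‖ ≤ B·F_b` at every site, `B` as in `norm_equiv_massive_solution_le` (K-free at the pins).
[cite: Balaban1985BackgroundPropagators, Thm 3.1 (3.42) p.397, (3.25) p.394] -/
theorem norm_equiv_massiveInverse_apply_le
    (G : SiteL2K ℂ 3 (periodsT3 F K) c₀ W₂ →ₗ[ℂ] SiteL2K ℂ 3 (periodsT3 F K) c₀ W₂)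
    (hAG : ∀ f, covLapSite F n K c₀ U₀ (G f) + (a : ℂ) • T (ι (Q'' (G f))) = f)
    (f : SiteL2K ℂ 3 (periodsT3 F K) c₀ W₂)
    (S : Finset (TSite 3 (periodsT3 F K))) (hfS : ∀ y, y ∉ S → WL2.equiv ℂ _ W₂ f y = 0)
    {Fb : ℝ} (hF : ∀ y, ‖WL2.equiv ℂ _ W₂ f y‖ ≤ Fb) (xt : TSite 3 (periodsT3 F K)) :
    ‖WL2.equiv ℂ _ W₂ (G f) xt‖
      ≤ (2 + (2 * (a * ((5 / 4) * Real.sqrt (2 * c₁) * ((((F.P K).L : ℝ) ^ (F.P K).d) ^ (K - n))⁻¹ / c₀) *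
                  Real.sqrt ((25 / 8) * (c₁ * ((((F.P K).L : ℝ) ^ (F.P K).d) ^ (K - n))⁻¹ / c₀)))
              + Real.sqrt (3 ^ 3 / (c₀ * ((F.L : ℝ) ^ (K - n)) ^ 3)))
            * max 2 (16 * c₀ * ((F.L : ℝ) ^ (K - n)) ^ 3 / (a * c₁)) * Real.sqrt (c₀ * S.card)) * Fb :=
  norm_equiv_massive_solution_le F h hε₀ hε7 U₀ hreg Q'' hseq ι hι T hT ha (G f) f (hAG f) S hfS hF xt

end Summit.QuantumFields.YangMills.Theorems.Prop7MassivePropagatorSupBound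

end
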